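import Mathlib
import Summits.MatrixMultiplication.Statement
import Summits.MatrixMultiplication.MatrixMultiplication.Theorems.GraphEquationsForwardAD
import Summits.MatrixMultiplication.MatrixMultiplication.Theorems.GraphEquationsFiniteOrder
import Summits.MatrixMultiplication.MatrixMultiplication.Theorems.GraphEquationsGenerators

/-!
# Graph equations — THE DEEP REGIME OF THE MEMBERSHIP LADDER IS FREE (M19d)

The finite range of `MultiplicityReduction`, read in the MEMBERSHIP-EXPONENT currency of
`GraphEquationsFiniteOrder` / `GraphEquationsNullExp` (`e(E)` = least `e` with `f_q^e ∈ J_E` for all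
`q`; finite for every correct system), has a regime that costs NOTHING beyond forward-mode AD:

* `derivC_mem_pow_of_mem_pow_succ` — a derivation lowers ideal powers by one: `u ∈ I^{d+1} ⇒
  D_μ u ∈ I^d`.  Hence while ALL tests lie in `I(W)^d` with `d ≥ 2`, EVERY coefficient field — in
  particular the CONSTANT field `μ ≡ 1`, computed at cost `n²` — is a kernel field, and the
  forward-mode derivative system (tree `forwardModeAD`, cost `≤ 4·cost + n²`) is again CORRECT.
* `derivC_pow_succ`, `derivC_generator` — `D_μ(f_q^{e+1}) = (e+1)·f_q^e·ι(μ_q)`; with `μ ≡ 1` the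
  derivative of the member `f_q^{e+1}` is `(e+1) f_q^e`, a member of the deflated system:
  `EqSystem.Correct.exists_deflation_pow_pred` — ONE FREE STEP `e+1 ↦ e` on systems with tests in
  `I^{d+2}`, landing in tests `∈ I^{d+1}`.
* `EqSystem.Correct.exists_sq_mem_of_deep` — iterating: a correct system with tests in `I^{k+1}` and
  `f_q^{k+2} ∈ J_E` has a correct descendant with SQUARE membership `f_q² ∈ J` and
  `cost + n² ≤ 4^k (cost E + n²)`.
* `omega_le_of_generator_pow_mem_of_deep` — **TIGHT FAMILIES PURIFY FOR FREE**: a cost-`n^β`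
  family of correct systems with tests in `I^{e-1}` and `f_q^e ∈ J_E` (membership exponent at
  most depth `+ 1`) forces `ω ≤ β`, by the square-membership criterion
  `omega_le_of_generator_sq_mem` (M19b, via rung `2` of BOP′).  In particular the WITNESS families
  of `witness_orderReduction_not_free` (iterated squarings, tests `f_q^{2^K}`, order `> K` for
  every `K`) are purified at the same exponent: unbounded isolation order is not by itself an
  obstruction — depth travels with it.

WHERE THE DIFFICULTY LIVES (lens 5).  The free step stops exactly when a test acquires a nonzero
LINEAR part along `W` (depth `1`) while the membership exponent is still `≥ 3`: then kernel fields
are no longer constant, kernel SECTIONS (`kernelJetLift`, B2) replace them, their Taylor garbage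
must be absorbed, and the generic polar step (`GenericPolarStep`, NODE-g32 §3) enters.  The whole
content of the rungs `K ≥ 3` of BOP′ is the SHALLOW regime `e(E) − depth(E) ≥ 2`.
-/

set_option linter.dupNamespace false

noncomputable section

open scoped BigOperators

namespace Summit.MatrixMultiplication.MatrixMultiplication.Theorems.GraphEquations

open MvPolynomial
open Literature.Computability.AlgebraicComplexity

variable {n : ℕ}

/-! ## Derivations lower ideal powers by one -/

/-- **`D_μ (J^{d+1}) ⊆ J^d`** for every coefficient field `μ` and every ideal `J`: the Leibniz rule. -/
theorem derivC_mem_pow_of_mem_pow_succ (μ : Fin n × Fin n → MvPolynomial (MatMulVars n) ℂ)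
    (J : Ideal (MvPolynomial (GraphVars n) ℂ)) :
    ∀ (d : ℕ) {u : MvPolynomial (GraphVars n) ℂ}, u ∈ J ^ (d + 1) → derivC μ u ∈ J ^ d
  | 0, u, _ => by simp
  | d + 1, u, hu => by
    rw [pow_succ] at hu
    refine Submodule.mul_induction_on hu (fun a ha b hb => ?_) (fun x y hx hy => ?_)
    · rw [derivC_mul]
      refine (J ^ (d + 1)).add_mem ?_ (Ideal.mul_mem_right _ _ ha)
      rw [pow_succ]
      exact Ideal.mul_mem_mul (derivC_mem_pow_of_mem_pow_succ μ J d ha) hb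
    · rw [derivC_add]
      exact (J ^ (d + 1)).add_mem hx hy

/-- **`D_μ f_q = ι(μ_q)`**: the generators are coordinates transverse to `W`. -/
theorem derivC_generator (μ : Fin n × Fin n → MvPolynomial (MatMulVars n) ℂ) (q : Fin n × Fin n) :
    derivC μ (generator n q) = liftAB n (μ q) := by
  classical
  simp only [derivC, pderiv_inr_generator_eq_ite, mul_ite, mul_one, mul_zero, Finset.sum_ite_eq,
    Finset.mem_univ, if_true]

/-- **`D_μ (u^{e+1}) = (e+1)·u^e·D_μ u`**. -/
theorem derivC_pow_succ (μ : Fin n × Fin n → MvPolynomial (MatMulVars n) ℂ)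
    (u : MvPolynomial (GraphVars n) ℂ) :
    ∀ e : ℕ, derivC μ (u ^ (e + 1)) = ((e : MvPolynomial (GraphVars n) ℂ) + 1) * u ^ e * derivC μ u
  | 0 => by simp
  | e + 1 => by
    rw [pow_succ, derivC_mul, derivC_pow_succ μ u e]
    push_cast
    ring

/-- With the constant field `μ ≡ 1`: `D(f_q^{e+1}) = (e+1)·f_q^e`. -/
theorem derivC_one_generator_pow_succ (q : Fin n × Fin n) (e : ℕ) :
    derivC (fun _ : Fin n × Fin n => (C 1 : MvPolynomial (MatMulVars n) ℂ)) (generator n q ^ (e + 1)) =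
      ((e : MvPolynomial (GraphVars n) ℂ) + 1) * generator n q ^ e := by
  rw [derivC_pow_succ, derivC_generator, liftAB_C, C_1, mul_one]

/-! ## One free step: constant-field deflation of a deep system -/

namespace EqSystem

/-- The test set of a system containing the `μ`-deflation of `E` contains the test set of `E`. -/
theorem DeflatesTo.testSet_subset {E E' : EqSystem n} {μ : Fin n × Fin n → MvPolynomial (MatMulVars n) ℂ}
    (hD : E.DeflatesTo μ E') :
    (Set.range fun o : Fin E.tests.length => E.testPoly (E.tests.get o)) ⊆
      Set.range fun o : Fin E'.tests.length => E'.testPoly (E'.tests.get o) := by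
  rintro _ ⟨o, rfl⟩
  obtain ⟨j', hj', he⟩ := hD.1 _ (List.get_mem _ o)
  obtain ⟨o', ho'⟩ := List.get_of_mem hj'
  exact ⟨o', show E'.testPoly (E'.tests.get o') = E.testPoly (E.tests.get o) by rw [ho', he]⟩

/-- … and the derivative of every test of `E`. -/
theorem DeflatesTo.derivC_mem_testSet {E E' : EqSystem n}
    {μ : Fin n × Fin n → MvPolynomial (MatMulVars n) ℂ} (hD : E.DeflatesTo μ E') :
    ∀ t ∈ (Set.range fun o : Fin E.tests.length => E.testPoly (E.tests.get o)),
      derivC μ t ∈ Set.range fun o : Fin E'.tests.length => E'.testPoly (E'.tests.get o) := by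
  rintro _ ⟨o, rfl⟩
  obtain ⟨j', hj', he⟩ := hD.2 _ (List.get_mem _ o)
  obtain ⟨o', ho'⟩ := List.get_of_mem hj'
  exact ⟨o', show E'.testPoly (E'.tests.get o') = derivC μ (E.testPoly (E.tests.get o)) by rw [ho', he]⟩

/-- Members are mapped to members: `u ∈ J_E ⇒ D_μ u ∈ J_{E'}` when `E'` contains the
`μ`-deflation of `E`. -/
theorem DeflatesTo.derivC_mem_span {E E' : EqSystem n}
    {μ : Fin n × Fin n → MvPolynomial (MatMulVars n) ℂ} (hD : E.DeflatesTo μ E')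
    {u : MvPolynomial (GraphVars n) ℂ}
    (hu : u ∈ Ideal.span (Set.range fun o : Fin E.tests.length => E.testPoly (E.tests.get o))) :
    derivC μ u ∈ Ideal.span (Set.range fun o : Fin E'.tests.length => E'.testPoly (E'.tests.get o)) :=
  GraphEquations.derivC_mem_span μ hD.testSet_subset hD.derivC_mem_testSet hu

/-- **ONE FREE STEP `e+1 ↦ e`.**  A CORRECT system whose tests lie in `I^{d+2}` and whose ideal
contains `f_q^{e+1}` for every `q` has a CORRECT forward-mode derivative system (constant field
`μ ≡ 1`) with tests in `I^{d+1}`, containing `f_q^e` for every `q`, of cost `≤ 4·cost E + n²`.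
No kernel section, no garbage, no genericity: every field is a kernel field of a deep system. -/
theorem Correct.exists_deflation_pow_pred {E : EqSystem n} (hE : E.Correct) {d e : ℕ}
    (hdeep : ∀ j ∈ E.tests, E.testPoly j ∈ graphIdeal n ^ (d + 2))
    (hmem : ∀ q : Fin n × Fin n, generator n q ^ (e + 1) ∈
      Ideal.span (Set.range fun o : Fin E.tests.length => E.testPoly (E.tests.get o))) :
    ∃ E' : EqSystem n, E'.Correct ∧ (∀ j ∈ E'.tests, E'.testPoly j ∈ graphIdeal n ^ (d + 1)) ∧
      (∀ q : Fin n × Fin n, generator n q ^ e ∈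
        Ideal.span (Set.range fun o : Fin E'.tests.length => E'.testPoly (E'.tests.get o))) ∧
      E'.cost ≤ 4 * E.cost + n * n := by
  set μ : Fin n × Fin n → MvPolynomial (MatMulVars n) ℂ := fun _ => C 1 with hμdef
  have hμ : ∀ q, ∃ j ∈ (constSystem (fun _ : Fin n × Fin n => (1 : ℂ))).tests,
      (constSystem (fun _ : Fin n × Fin n => (1 : ℂ))).testPoly j = liftAB n (μ q) := fun q =>
    ⟨_, by simpa [constSystem, List.mem_range] using ((Fintype.equivFin (Fin n × Fin n)) q).isLt,
      constSystem_testPoly _ q⟩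
  obtain ⟨E', hfan, hD, hshape, hcost⟩ :=
    forwardModeAD n E (constSystem fun _ => (1 : ℂ)) μ hE.1 (constSystem_isFanInTwo _) hμ
  have hKF : ∀ j ∈ E.tests, derivC μ (E.testPoly j) ∈ graphIdeal n := fun j hj =>
    Ideal.pow_le_self (Nat.succ_ne_zero d) (derivC_mem_pow_of_mem_pow_succ μ _ (d + 1) (hdeep j hj))
  have hE' : E'.Correct := hE.of_deflatesTo hfan hD hshape hKF
  refine ⟨E', hE', fun j' hj' => ?_, fun q => ?_, (constSystem_cost _) ▸ hcost⟩
  · rcases hshape j' hj' with ⟨j, hj, he⟩ | ⟨j, hj, he⟩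
    · rw [he]; exact Ideal.pow_le_pow_right (Nat.le_succ _) (hdeep j hj)
    · rw [he]; exact derivC_mem_pow_of_mem_pow_succ μ _ (d + 1) (hdeep j hj)
  · have h1 := hD.derivC_mem_span (hmem q)
    rw [hμdef, derivC_one_generator_pow_succ] at h1
    have he : ((e : MvPolynomial (GraphVars n) ℂ) + 1) = C ((e : ℂ) + 1) := by simp
    have hunit : C (((e : ℂ) + 1)⁻¹) * (((e : MvPolynomial (GraphVars n) ℂ) + 1) * generator n q ^ e) =
        generator n q ^ e := by
      rw [he, ← mul_assoc, ← C_mul, inv_mul_cancel₀ (Nat.cast_add_one_ne_zero e), C_1, one_mul]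
    rw [← hunit]
    exact Ideal.mul_mem_left _ _ h1

/-- **THE DEEP DESCENT.**  A CORRECT system with tests in `I^{k+1}` and `f_q^{k+2} ∈ J_E` for all
`q` has a CORRECT descendant with SQUARE MEMBERSHIP `f_q² ∈ J` and `cost + n² ≤ 4^k·(cost E + n²)`:
`k` free steps, each keeping the tests one power deeper than needed for the next. -/
theorem Correct.exists_sq_mem_of_deep :
    ∀ (k : ℕ) {E : EqSystem n}, E.Correct →
      (∀ j ∈ E.tests, E.testPoly j ∈ graphIdeal n ^ (k + 1)) →
      (∀ q : Fin n × Fin n, generator n q ^ (k + 2) ∈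
        Ideal.span (Set.range fun o : Fin E.tests.length => E.testPoly (E.tests.get o))) →
      ∃ E' : EqSystem n, E'.Correct ∧
        (∀ q : Fin n × Fin n, generator n q ^ 2 ∈
          Ideal.span (Set.range fun o : Fin E'.tests.length => E'.testPoly (E'.tests.get o))) ∧
        E'.cost + n * n ≤ 4 ^ k * (E.cost + n * n)
  | 0, E, hE, _, hmem => ⟨E, hE, hmem, by simp⟩
  | k + 1, E, hE, hdeep, hmem => by
    obtain ⟨E₁, hE₁, hdeep₁, hmem₁, hcost₁⟩ := hE.exists_deflation_pow_pred (d := k) (e := k + 2) hdeep hmem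
    obtain ⟨E', hE', hmem', hcost'⟩ := Correct.exists_sq_mem_of_deep k hE₁ hdeep₁ hmem₁
    refine ⟨E', hE', hmem', hcost'.trans ?_⟩
    calc 4 ^ k * (E₁.cost + n * n) ≤ 4 ^ k * (4 * (E.cost + n * n)) :=
          Nat.mul_le_mul_left _ (by omega)
      _ = 4 ^ (k + 1) * (E.cost + n * n) := by ring

end EqSystem

/-! ## Tight families purify for free -/

/-- **TIGHT FAMILIES PURIFY FOR FREE.**  For `β ≥ 2` and `e = k + 2 ≥ 2`: a cost-`n^β` family of
CORRECT systems whose tests lie in `I(W)^{e-1}` and whose ideals contain `f_q^e` (membership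
exponent at most depth `+ 1`) forces `ω ≤ β` — `k` free constant-field deflation steps
(`exists_sq_mem_of_deep`, cost factor `4^k`) followed by the square-membership criterion
`omega_le_of_generator_sq_mem` (rung `2` of BOP′).  Unconditional for EVERY exponent `e`: the
deep regime of the membership ladder carries no difficulty; the iterated-squaring witnesses of
`witness_orderReduction_not_free` fall under it. -/
theorem omega_le_of_generator_pow_mem_of_deep {β : ℝ} (hβ : 2 ≤ β) (k : ℕ)
    (h : ∃ c : ℝ, ∀ n : ℕ, 1 ≤ n → ∃ E : EqSystem n, E.Correct ∧
      (∀ j ∈ E.tests, E.testPoly j ∈ graphIdeal n ^ (k + 1)) ∧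
      (∀ q : Fin n × Fin n, generator n q ^ (k + 2) ∈
        Ideal.span (Set.range fun o : Fin E.tests.length => E.testPoly (E.tests.get o))) ∧
      (E.cost : ℝ) ≤ c * (n : ℝ) ^ β) :
    omega ℂ ≤ β := by
  obtain ⟨c, hc⟩ := h
  refine omega_le_of_generator_sq_mem hβ ⟨4 ^ k * (c + 1), fun n hn => ?_⟩
  obtain ⟨E, hE, hdeep, hmem, hcost⟩ := hc n hn
  obtain ⟨E', hE', hmem', hcost'⟩ := hE.exists_sq_mem_of_deep k hdeep hmem
  refine ⟨E', hE', hmem', ?_⟩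
  have hn1 : (1 : ℝ) ≤ n := by exact_mod_cast hn
  have hsq : ((n * n : ℕ) : ℝ) ≤ (n : ℝ) ^ β := by
    calc ((n * n : ℕ) : ℝ) = (n : ℝ) ^ ((2 : ℕ) : ℝ) := by rw [Real.rpow_natCast, sq]; push_cast; ring
      _ ≤ (n : ℝ) ^ β := Real.rpow_le_rpow_of_exponent_le hn1 (by exact_mod_cast hβ)
  have hc0 : 0 ≤ c := by
    have h0 : (0 : ℝ) ≤ c * (n : ℝ) ^ β := (Nat.cast_nonneg _).trans hcost
    exact nonneg_of_mul_nonneg_left h0 (Real.rpow_pos_of_pos (by exact_mod_cast hn) β)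
  have h1 : ((E'.cost : ℕ) : ℝ) ≤ (4 : ℝ) ^ k * ((E.cost : ℝ) + ((n * n : ℕ) : ℝ)) := by
    have := hcost'
    have h2 : (E'.cost : ℝ) + ((n * n : ℕ) : ℝ) ≤ (4 : ℝ) ^ k * ((E.cost : ℝ) + ((n * n : ℕ) : ℝ)) := by
      exact_mod_cast this
    linarith [(Nat.cast_nonneg (n * n) : (0 : ℝ) ≤ ((n * n : ℕ) : ℝ))]
  calc ((E'.cost : ℕ) : ℝ) ≤ (4 : ℝ) ^ k * ((E.cost : ℝ) + ((n * n : ℕ) : ℝ)) := h1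
    _ ≤ (4 : ℝ) ^ k * (c * (n : ℝ) ^ β + (n : ℝ) ^ β) :=
        mul_le_mul_of_nonneg_left (add_le_add hcost hsq) (by positivity)
    _ = 4 ^ k * (c + 1) * (n : ℝ) ^ β := by ring

/-- The same in the currency of the route: a TIGHT admissible family at `β` gives PURE (reduced)
admissibility at every `β' > β`. -/
theorem eqAdmissibleRed_of_generator_pow_mem_of_deep {β : ℝ} (hβ : 2 ≤ β) (k : ℕ)
    (h : ∃ c : ℝ, ∀ n : ℕ, 1 ≤ n → ∃ E : EqSystem n, E.Correct ∧
      (∀ j ∈ E.tests, E.testPoly j ∈ graphIdeal n ^ (k + 1)) ∧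
      (∀ q : Fin n × Fin n, generator n q ^ (k + 2) ∈
        Ideal.span (Set.range fun o : Fin E.tests.length => E.testPoly (E.tests.get o))) ∧
      (E.cost : ℝ) ≤ c * (n : ℝ) ^ β) :
    ∀ β' : ℝ, β < β' → EqAdmissibleRed β' := fun _ hβ' =>
  eqAdmissibleRed_of_omega_lt ((omega_le_of_generator_pow_mem_of_deep hβ k h).trans_lt hβ')

end Summit.MatrixMultiplication.MatrixMultiplication.Theorems.GraphEquations

end
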